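/-
Origin: expansion seat `planner-pub-hodgecm-toy2-g7-0`, handover #1 v2 HANDOVER 2026-08-18T12:56:25Z (STATUS l.3779) md5 1e3992f4 doc-only over CLAIM 9bf95c31; rewrite ToyG3.DescentFacts3 (packager row: handed in STATUS without a t30 kit row; RUN 30 addendum) (`HOME/pub-hodgecm-toy2-g7/lean/Toy2g7/PadWithFace.lean`, md5 1e3992f4, 216 lines);
landed by the gen-8 packager in gate run 30 as `HodgeCM/Model/Toy/PadWithFace.lean` (import ^import ToyG3\.DescentFacts3[ \t]*$→import HodgeCM.Model.ToyG2.DescentFacts3 ×1).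
-/
/-
Copyright: pub-hodgecm formalisation cell (harness21, 2026). New file (not vendored).
Origin: HOME/pub-hodgecm-toy2-g7/lean/Toy2g7/PadWithFace.lean — session planner-pub-hodgecm-toy2-g7-0 (unit pub-hodgecm-toy2-g7,
CONSISTENCY seat 2, part (6a)(ii), generation 7).  WIP module `Toy2g7.PadWithFace`; intended final place
`HodgeCM/Model/Toy/PadWithFace.lean` (module `HodgeCM.Model.Toy.PadWithFace`; kind L5 consistency / non-vacuity layer).
WIP import to rewrite on landing: `import ToyG3.DescentFacts3` ↦ `import HodgeCM.Model.ToyG2.DescentFacts3`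
(toy-g3's RUN-29 row; this file lands AFTER it).
-/
import Mathlib
import Summits.HodgeConjecture.HodgeCM.Model.PadH6_3
import Summits.HodgeConjecture.HodgeCM.Model.ToyG2.SplitAllGood
import Summits.HodgeConjecture.HodgeCM.Model.ToyG2.DescentFacts3_2

/-!
# The padded universe WITH the realisation: `{N1, F-H0, F7d-B}` cannot ALL be dropped from `COR_CM_of_descentFactsB₄`

Load-bearing census of the binders of
`HodgeCM.Assembly.COR_CM_of_descentFactsB₄ (U) (M : U.ModelAxioms) (hR : U.RealisationExistsFace)
  (hN1 : U.Fact_cupExterior) (hN2 : U.Fact_cup_hodge) (h4 : U.Fact_cupAlg) (h5 : U.Fact_cupAssoc)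
  (hu : U.Fact_unitH0) (hb : U.Fact_gysinDescentB) (hd : U.Fact_dimProd) : U.HC_CM`.

The in-tree witnesses so far either drop the realisation `hR` (`HodgeCM.Toy.descentFactsB_not_sufficient`: all nine
facts, `¬ hR`, `¬ HC_CM`) or drop N1 WITHOUT the realisation (`HodgeCM.Universe.exists_model_not_pohlmannSpan`, on the
generation-1 toy model, where `RealisationExistsFace` fails).  This file pads the generation-2 toy universe
`toyUniverse₃ 1 4` (`HodgeCM.Model.ToyG2.*`), which HAS the realisation (`ThetaUiso.realisationExistsFace₃`) and all
28 model axioms (`toyUniverse₃_modelAxioms_all`), by the universe transform `Universe.padH6`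
(`H♯⁶ = H⁶ ⊕ H⁶`, the pad purely of type `(3,3)`, never algebraic, cup products through the first summand):

* generic (`namespace HodgeCM.Universe.PadH6`, any model `U` of `ModelAxioms ∧ N1 [∧ Fact_dimProd]`):
  `not_fact_unitH0` — F-H0 FAILS in `U♯` (the unit law `1 ∪ z = z` kills the pad component of `z`);
  `not_fact_gysinDescentB` — F7d-B FAILS in `U♯` (`e = (0, v)` a pad class on `A_Φ`, `ω` a top class of a second
  copy of `A_Φ`: `p_A^* e ∪ p_B^* ω = 0` is algebraic, `e` is not);
* toy (`namespace HodgeCM.ToyG2`): **`padUniverse₃_profile`** — `(toyUniverse₃ 1 4)♯` is a model of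
  `ModelAxioms ∧ RealisationExistsFace ∧ N2 ∧ N3 ∧ N4 ∧ F4 ∧ F5 ∧ Fact_dimProd` in which
  `N1`, `F-H0`, `F7d-B` and `HC_CM` all FAIL; packaged as the separation theorem
  **`descentFactsB₄_realised_not_sufficient_without_N1_unitH0_gysinDescentB`**.

Reading for the census: with the realisation present, the conjunction of the three binders `hN1 ∧ hu ∧ hb` is
load-bearing (the other seven binders `M, hR, hN2, h4, h5, hd` (+ N3, N4) hold and the conclusion fails).  It does NOT
separate the three from each other; single-binder witnesses for N1 / F-H0 / F7d-B with the realisation remain open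
(see `TOY2-G7.md` of the originating unit for the obstruction analysis).  All proofs kernel-checked; nothing is cited.
-/

noncomputable section

namespace HodgeCM

open Literature.AlgebraicGeometry.Motives (CMType)
open scoped TensorProduct

namespace Universe

namespace PadH6

variable {U : Universe}

/-! ## 1. Nonzero rational classes from weight lines (models of M + N1) -/

/-- A weight LINE of `H^k(A_Θ, ℂ)` yields a nonzero RATIONAL class in `H^k(A_Θ, ℚ)`. -/
theorem exists_coh_ne_zero_of_finrank_weightSpace {F : CMField} {n : ℕ} {Θ : Fin (n + 1) → CMType F}
    {S : Fin (n + 1) → Finset ((F : Type) →+* ℂ)} {k : ℕ}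
    (h : Module.finrank ℂ (U.weightSpace F Θ S k) = 1) : ∃ v : U.Coh (U.cmProd F Θ) k, v ≠ 0 := by
  by_contra hall
  push Not at hall
  have hz : ∀ z : U.CohC (U.cmProd F Θ) k, z = 0 := fun z => by
    induction z using TensorProduct.induction_on with
    | zero => rfl
    | tmul c v => rw [hall v, TensorProduct.tmul_zero]
    | add x y hx hy => rw [hx, hy, add_zero]
  have hpos : 0 < Module.finrank ℂ (U.weightSpace F Θ S k) := by rw [h]; exact Nat.one_pos
  obtain ⟨w, hw⟩ := Module.finrank_pos_iff_exists_ne_zero.mp hpos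
  exact hw (Subtype.ext (hz _))

/-- In a model of M + N1, over a CM field of degree `≥ 6`: `H⁶(A_Φ, ℚ) ≠ 0` (the weight line of any weight of size `6`). -/
theorem exists_coh6_ne_zero (M : U.ModelAxioms) (hN1 : U.Fact_cupExterior) {F : CMField}
    (h6 : 6 ≤ Module.finrank ℚ F) (Θ : Fin (0 + 1) → CMType F) :
    ∃ v : U.Coh (U.cmProd F Θ) 6, v ≠ 0 := by
  have hcard : 6 ≤ (Finset.univ : Finset ((F : Type) →+* ℂ)).card := by
    rw [Finset.card_univ, NumberField.Embeddings.card]; exact h6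
  obtain ⟨T, -, hT⟩ := Finset.exists_subset_card_eq hcard
  apply exists_coh_ne_zero_of_finrank_weightSpace (S := fun _ => T)
  rw [finrank_weightSpace M hN1 (by norm_num), if_pos]
  simp [hT]

/-- In a model of M + N1 + `Fact_dimProd`: the top degree `H^{2 dim}(A_Φ, ℚ) ≠ 0` (the weight line of the full weight). -/
theorem exists_cohTop_ne_zero (M : U.ModelAxioms) (hN1 : U.Fact_cupExterior) (hd : U.Fact_dimProd) {F : CMField}
    (Θ : Fin (0 + 1) → CMType F) :
    ∃ v : U.Coh (U.cmProd F Θ) (2 * U.dim (U.cmProd F Θ)), v ≠ 0 := by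
  have h2 : 2 * U.dim (U.cmProd F Θ) = (0 + 1) * Module.finrank ℚ F := U.two_mul_dim_cmProd_of_dimProd M hd F Θ
  have hfr : 0 < Module.finrank ℚ F := Module.finrank_pos
  have hpos : 0 < 2 * U.dim (U.cmProd F Θ) := by rw [h2]; omega
  apply exists_coh_ne_zero_of_finrank_weightSpace (S := fun _ => (Finset.univ : Finset ((F : Type) →+* ℂ)))
  rw [finrank_weightSpace M hN1 hpos, if_pos]
  rw [h2]
  simp [NumberField.Embeddings.card]

/-! ## 2. F-H0 fails in `U♯` -/

/-- **F-H0 (`Fact_unitH0`) FAILS in `U♯`** for every model `U` of M + N1: the unit law `1_X ∪ z = z` (clause 2) is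
violated by any pad class `z = (0, v)`, `v ≠ 0` in `H⁶(A_Φ, ℚ)` — the cup product of `U♯` has no pad component. -/
theorem not_fact_unitH0 (M : U.ModelAxioms) (hN1 : U.Fact_cupExterior) : ¬ U.padH6.Fact_unitH0 := by
  rintro ⟨one, -, hcup, -⟩
  obtain ⟨F, -, h6, f, -, -⟩ := faceHypothesesInhabited
  let Θ : Fin (0 + 1) → CMType F := fun _ => f.Φ
  obtain ⟨v, hv⟩ := exists_coh6_ne_zero M hN1 h6 Θ
  have h := congrArg (padOf (U := U) (U.cmProd F Θ) (0 + 6)) (hcup (U.cmProd F Θ) 6 (ofPad (U.cmProd F Θ) 6 v))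
  rw [padOf_cup, padOf_castCoh, padOf_six, ofPad_six] at h
  exact hv h.symm

/-! ## 3. F7d-B fails in `U♯` -/

/-- **F7d-B (`Fact_gysinDescentB`) FAILS in `U♯`** for every model `U` of M + N1 + `Fact_dimProd`.  Witness: `F` a
Galois CM field of degree `≥ 6` (`faceHypothesesInhabited`), `Ξ = (Φ, Φ)` (one factor on each side), the block pair of
`U♯` (`blockPair_exists` from M1, M2, M18 of `U♯`), `ω = (ω₀, 0)` with `ω₀ ≠ 0` a rational top class of `A_Φ`
(`exists_cohTop_ne_zero`), `p = 3`, `e = (0, v)` a nonzero pad class of `H♯⁶(A_Φ)`: `p_A^* e` has no geometric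
component, so `p_A^* e ∪ p_B^* ω = 0 ∈ Alg♯`, while `e ∉ Alg♯³ = Alg³ ⊕ 0`. -/
theorem not_fact_gysinDescentB (M : U.ModelAxioms) (hd : U.Fact_dimProd) (hN1 : U.Fact_cupExterior) :
    ¬ U.padH6.Fact_gysinDescentB := by
  intro hB
  obtain ⟨F, -, h6, f, -, -⟩ := faceHypothesesInhabited
  let Ξ : Fin (0 + 1 + (0 + 1)) → CMType F := fun _ => f.Φ
  have M' : U.padH6.ModelAxioms := modelAxioms M hd
  obtain ⟨pA, pB, hP⟩ := Universe.blockPair_exists (U := U.padH6) M'.pull_id M'.pull_comp M'.lift F 0 0 Ξ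
  obtain ⟨ω₀, hω₀⟩ : ∃ ω₀ : U.Coh (U.padH6.cmProd F (blkB Ξ)) (2 * U.padH6.dim (U.padH6.cmProd F (blkB Ξ))), ω₀ ≠ 0 :=
    exists_cohTop_ne_zero M hN1 hd (blkB Ξ)
  obtain ⟨v, hv⟩ : ∃ v : U.Coh (U.padH6.cmProd F (blkA Ξ)) 6, v ≠ 0 := exists_coh6_ne_zero M hN1 h6 (blkA Ξ)
  have hω : ofU (U := U) (U.padH6.cmProd F (blkB Ξ)) (2 * U.padH6.dim (U.padH6.cmProd F (blkB Ξ))) ω₀ ≠ 0 := fun h =>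
    hω₀ (ofU_injective (U := U) _ _ (h.trans (map_zero _).symm))
  have h1 : toU (U := U) (U.padH6.cmProd F Ξ) (2 * 3)
      (U.padH6.pull pA (2 * 3) (ofPad (U := U) (U.padH6.cmProd F (blkA Ξ)) (2 * 3) v)) = 0 := by
    rw [toU_pull, toU_ofPad, map_zero]
  have key := hB F 0 0 Ξ pA pB hP (ofU (U := U) (U.padH6.cmProd F (blkB Ξ)) (2 * U.padH6.dim (U.padH6.cmProd F (blkB Ξ))) ω₀)
    hω 3 (ofPad (U := U) (U.padH6.cmProd F (blkA Ξ)) (2 * 3) v)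
    (by
      rw [cup_def, h1, LinearMap.map_zero₂, map_zero, map_zero]
      exact Submodule.zero_mem _)
  have key' : (ofPad (U.cmProd F (blkA Ξ)) 6 v : U.padH6.Coh (U.cmProd F (blkA Ξ)) (2 * 3)) ∈
      U.padH6.alg (U.cmProd F (blkA Ξ)) 3 := key
  exact hv ((ofPad_mem_alg_iff (U := U) _ v).mp key')

/-! ## 4. The separation theorem, generic form -/

/-- **Separation theorem (generic).**  If `ModelAxioms ∧ RealisationExistsFace ∧ N1 ∧ N2 ∧ N3 ∧ N4 ∧ F4 ∧ F5 ∧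
Fact_dimProd` has a model, then `ModelAxioms ∧ RealisationExistsFace ∧ N2 ∧ N3 ∧ N4 ∧ F4 ∧ F5 ∧ Fact_dimProd` has a
model in which N1, F-H0, F7d-B and COR-CM all FAIL. -/
theorem exists_realised_model_not_unitH0_not_gysinDescentB
    (h : ∃ U : Universe, U.ModelAxioms ∧ U.RealisationExistsFace ∧ U.Fact_cupExterior ∧ U.Fact_cup_hodge ∧
      U.Fact_pull_H0 ∧ U.Fact_hodge_F0 ∧ U.Fact_cupAlg ∧ U.Fact_cupAssoc ∧ U.Fact_dimProd) :
    ∃ U : Universe, U.ModelAxioms ∧ U.RealisationExistsFace ∧ U.Fact_cup_hodge ∧ U.Fact_pull_H0 ∧ U.Fact_hodge_F0 ∧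
      U.Fact_cupAlg ∧ U.Fact_cupAssoc ∧ U.Fact_dimProd ∧
      ¬ U.Fact_cupExterior ∧ ¬ U.Fact_unitH0 ∧ ¬ U.Fact_gysinDescentB ∧ ¬ U.HC_CM := by
  obtain ⟨U, M, hR, hN1, hN2, hN3, hN4, h4, h5, hd⟩ := h
  exact ⟨U.padH6, modelAxioms M hd, realisationExistsFace hR, fact_cup_hodge hN2, fact_pull_H0_iff.mpr hN3,
    fact_hodge_F0 hN4, fact_cupAlg h4, fact_cupAssoc h5, fact_dimProd_iff.mpr hd,
    not_fact_cupExterior M hd hN1 hN2 hN3 hN4, not_fact_unitH0 M hN1, not_fact_gysinDescentB M hd hN1, not_hc_cm M hN1⟩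

end PadH6

end Universe

/-! ## 5. The instance: the padded generation-2 toy universe -/

namespace ToyG2

open HodgeCM.Toy Universe

/-- the padded generation-2 toy universe on good objects (`d = 1`, `t = 4`, so `t² = 16`) -/
abbrev padUniverse₃ : Universe := (toyUniverse₃ 1 4).padH6

/-- **Profile of `(toyUniverse₃ 1 4)♯`**: `ModelAxioms`, the realisation, N2, N3, N4, F4, F5, `Fact_dimProd` hold;
N1, F-H0, F7d-B and COR-CM fail. -/
theorem padUniverse₃_profile :
    padUniverse₃.ModelAxioms ∧ padUniverse₃.RealisationExistsFace ∧ padUniverse₃.Fact_cup_hodge ∧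
      padUniverse₃.Fact_pull_H0 ∧ padUniverse₃.Fact_hodge_F0 ∧ padUniverse₃.Fact_cupAlg ∧ padUniverse₃.Fact_cupAssoc ∧
      padUniverse₃.Fact_dimProd ∧
      ¬ padUniverse₃.Fact_cupExterior ∧ ¬ padUniverse₃.Fact_unitH0 ∧ ¬ padUniverse₃.Fact_gysinDescentB ∧
      ¬ padUniverse₃.HC_CM :=
  have M : (toyUniverse₃ 1 4).ModelAxioms := toyUniverse₃_modelAxioms_all 1 4
  have hR : (toyUniverse₃ 1 4).RealisationExistsFace := ThetaUiso.realisationExistsFace₃ 1 4 le_rfl (by norm_num)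
  have hN1 : (toyUniverse₃ 1 4).Fact_cupExterior := fact3_cupExterior exteriorHodgeData traceSys (gplOf 1 4)
  have hN2 : (toyUniverse₃ 1 4).Fact_cup_hodge := fact3_cup_hodge traceSys (gplOf 1 4)
  have hN3 : (toyUniverse₃ 1 4).Fact_pull_H0 := fact3_pull_H0 exteriorHodgeData traceSys (gplOf 1 4)
  have hN4 : (toyUniverse₃ 1 4).Fact_hodge_F0 := fact3_hodge_F0 traceSys (gplOf 1 4)
  have h4 : (toyUniverse₃ 1 4).Fact_cupAlg := fact3_cupAlg traceSys (gplOf 1 4)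
  have h5 : (toyUniverse₃ 1 4).Fact_cupAssoc := fact3_cupAssoc exteriorHodgeData traceSys (gplOf 1 4)
  have hd : (toyUniverse₃ 1 4).Fact_dimProd := fact3_dimProd exteriorHodgeData traceSys (gplOf 1 4)
  ⟨PadH6.modelAxioms M hd, PadH6.realisationExistsFace hR, PadH6.fact_cup_hodge hN2, PadH6.fact_pull_H0_iff.mpr hN3,
    PadH6.fact_hodge_F0 hN4, PadH6.fact_cupAlg h4, PadH6.fact_cupAssoc h5, PadH6.fact_dimProd_iff.mpr hd,
    PadH6.not_fact_cupExterior M hd hN1 hN2 hN3 hN4, PadH6.not_fact_unitH0 M hN1, PadH6.not_fact_gysinDescentB M hd hN1,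
    PadH6.not_hc_cm M hN1⟩

/-- **Separation theorem (unconditional): with the realisation present, `{N1, F-H0, F7d-B}` cannot ALL be dropped from
`COR_CM_of_descentFactsB₄`** (a JOINT statement — hR, N2–N4, F4, F5, D hold and `HC_CM` fails — not per-binder
independence).  There is a universe satisfying `ModelAxioms`, `RealisationExistsFace`, N2, N3, N4, F4, F5 and
`Fact_dimProd` in which N1, F-H0, F7d-B — and the conclusion `HC_CM` — fail. -/
theorem descentFactsB₄_realised_not_sufficient_without_N1_unitH0_gysinDescentB :
    ∃ U : Universe, U.ModelAxioms ∧ U.RealisationExistsFace ∧ U.Fact_cup_hodge ∧ U.Fact_pull_H0 ∧ U.Fact_hodge_F0 ∧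
      U.Fact_cupAlg ∧ U.Fact_cupAssoc ∧ U.Fact_dimProd ∧
      ¬ U.Fact_cupExterior ∧ ¬ U.Fact_unitH0 ∧ ¬ U.Fact_gysinDescentB ∧ ¬ U.HC_CM :=
  ⟨padUniverse₃, padUniverse₃_profile⟩

/-- The same, read against the binder list of `COR_CM_of_descentFactsB₄`: the implication
"`M ∧ hR ∧ hN2 ∧ h4 ∧ h5 ∧ hd → (hN1 ∧ hu ∧ hb)`" is FALSE, and so is "`M ∧ hR ∧ hN2 ∧ h4 ∧ h5 ∧ hd → HC_CM`". -/
theorem not_descentFactsB₄_without_N1_unitH0_gysinDescentB :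
    ¬ ∀ U : Universe, U.ModelAxioms → U.RealisationExistsFace → U.Fact_cup_hodge → U.Fact_cupAlg → U.Fact_cupAssoc →
      U.Fact_dimProd → U.HC_CM := by
  intro h
  obtain ⟨U, M, hR, hN2, -, -, h4, h5, hd, -, -, -, hHC⟩ :=
    descentFactsB₄_realised_not_sufficient_without_N1_unitH0_gysinDescentB
  exact hHC (h U M hR hN2 h4 h5 hd)

end ToyG2

end HodgeCM

end
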